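import Summits.ResolutionOfSingularities.ResolutionOfSingularities.Theorems.PurelyInseparableDim4WildConesAllFields
import Summits.ResolutionOfSingularities.ResolutionOfSingularities.Theorems.PurelyInseparableDim4UniformTrapScope
import HarnessLib
import HarnessLib.Audit.Tags

/-!
# Purely inseparable four-folds — specimens of the sub-regime «`J₃⁺`-isolated but Milnor-infinite»
# (bridge WildCones ↔ `PIDim4`, census values; cell `res-dim4-pi`, p-12, width 12)

[OURS · counted 0 · worked instances only; nothing here is a statement about resolution of
singularities.]

The bridge files (`…WildConesAllFields`) prove `F4-I(p,p)` on every chain whose `J_p⁺`-isolated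
states have FINITE formal Milnor algebra `K⟦x⟧ ⧸ ⟨∂ᵢ ↑F⟩`, and reduce `NoIsolatedTrap p p` to the
absence of isolated chains with cofinally many Milnor-INFINITE states
(`noIsolatedTrap_iff_no_cofinal_milnorInfinite`).  At `p = 2` the two notions agree
(`milnorFinite_of_isIsolated_two`).  This file records that for `p = 3` they do NOT: the
uncovered sub-regime is inhabited, on the floor (`ord F = 3`) and in the band (`ord F = 4`).

* §1 `not_milnorFinite_of_coeff_single_pderiv_eq_zero` — a usable test for an INFINITE formal
  Milnor algebra: if no partial derivative `∂ₜF` has a pure power `xᵢⁿ` (or constant) among its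
  monomials — i.e. the gradient vanishes along the `xᵢ`-axis — then `K⟦x⟧ ⧸ ⟨∂ₜ ↑F⟩` is not finite
  over `K` (every element of the formal Jacobian ideal has zero `xᵢⁿ`-coefficients, while
  finiteness would put `xᵢᴺ ∈ 𝔪̂ᴺ` inside it).
* §2 Hasse-derivative bookkeeping on monomials.
* §3 **Floor specimen** `F = x₁x₂x₃ + x₄⁴`, `char K = 3`: `J₃⁺(F) ∋ x₁, x₂, x₃` (second Hasse
  derivatives) and `∋ x₄³ = D^{(e₄)}F` (`4 = 1`), so `𝔪₀³ ≤ J₃⁺(F) ≤ 𝔪₀` and the origin is an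
  ISOLATED triple point of `z³ + F` (`isIsolated_three_floorSpecimen`); but `∂F = (x₂x₃, x₁x₃,
  x₁x₂, x₄³)` vanishes on the `x₁`-axis, so the formal Milnor algebra is INFINITE
  (`not_milnorFinite_floorSpecimen`).
* The band specimen `G = x₁²x₂² + x₃⁴ + x₄⁴` (order `4`) is treated the same way in the companion
  file `…WildConesGapSpecimenBand`.

So the hypothesis «Milnor-finite» of the in-house route `WildCones` is strictly stronger than
`J_p⁺`-isolation for `p ≥ 3`, already for clean states of the frame.  Nothing here proves
`NoIsolatedTrap 3 3` or resolution of singularities in dimension ≥ 4 / characteristic `p`.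
bears_on: LADDER-RESOLUTION:D157-DOOR2 (res-dim4-pi · F4-I(3,3) census).
Supports stmt-ResolutionOfSingularities-16155 (helper).
-/

set_option linter.dupNamespace false

noncomputable section

namespace Summit.ResolutionOfSingularities.ResolutionOfSingularities.Theorems.PIDim4

namespace WildConesBridge

open MvPolynomial Finset IsLocalRing
open Literature.AlgebraicGeometry.Resolution

variable {K : Type} [Field K]

/-! ## 1. A test for an infinite formal Milnor algebra -/

/-- If every `∂ₜF` has zero coefficient at every pure power `xᵢⁿ`, then so has every element of the
formal Jacobian ideal `⟨∂ₜ ↑F⟩ ⊂ K⟦x⟧` (the ideal lies in `(xⱼ : j ≠ i)`). [folklore] -/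
theorem coeff_single_eq_zero_of_mem_span_pderiv_coe {F : MvPolynomial (Fin 4) K} {i : Fin 4}
    (h : ∀ (t : Fin 4) (n : ℕ), coeff (Finsupp.single i n) (pderiv t F) = 0)
    {g : MvPowerSeries (Fin 4) K}
    (hg : g ∈ Ideal.span
      (Set.range fun t : Fin 4 => MvPowerSeries.pderiv t (F : MvPowerSeries (Fin 4) K)))
    (n : ℕ) : MvPowerSeries.coeff (Finsupp.single i n) g = 0 := by
  classical
  induction hg using Submodule.span_induction generalizing n with
  | mem x hx =>
    obtain ⟨t, rfl⟩ := hx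
    show MvPowerSeries.coeff (Finsupp.single i n)
      (MvPowerSeries.pderiv t (F : MvPowerSeries (Fin 4) K)) = 0
    rw [MvPowerSeries.pderiv_coe, MvPolynomial.coeff_coe, h]
  | zero => exact map_zero _
  | add x y _ _ hx hy => rw [map_add, hx, hy, add_zero]
  | smul a x _ hx =>
    rw [smul_eq_mul, MvPowerSeries.coeff_mul]
    refine Finset.sum_eq_zero fun q hq => ?_
    rw [Finset.HasAntidiagonal.mem_antidiagonal] at hq
    have hq2 : q.2 = Finsupp.single i (q.2 i) := by
      ext j
      by_cases hji : j = i
      · subst hji; rw [Finsupp.single_eq_same]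
      · have hj := congrArg (fun f : Fin 4 →₀ ℕ => f j) hq
        simp only [Finsupp.add_apply, Finsupp.single_apply, if_neg (Ne.symm hji)] at hj
        rw [Finsupp.single_apply, if_neg (Ne.symm hji)]
        omega
    rw [hq2, hx, mul_zero]

/-- **Test for an INFINITE formal Milnor algebra.** If no partial derivative `∂ₜF` contains a pure
power `xᵢⁿ` (the gradient of `F` vanishes along the `xᵢ`-axis), then `K⟦x⟧ ⧸ ⟨∂₁↑F, …, ∂₄↑F⟩` is not
finite over `K`: finiteness gives `𝔪̂ᴺ ≤ ⟨∂ₜ ↑F⟩ ∋ xᵢᴺ` (`exists_maximalIdeal_pow_le_of_finite`),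
contradicting the previous lemma. [folklore] -/
theorem not_milnorFinite_of_coeff_single_pderiv_eq_zero {F : MvPolynomial (Fin 4) K} (i : Fin 4)
    (h : ∀ (t : Fin 4) (n : ℕ), coeff (Finsupp.single i n) (pderiv t F) = 0) :
    ¬ Module.Finite K (MvPowerSeries (Fin 4) K ⧸
      Ideal.span (Set.range fun t : Fin 4 => MvPowerSeries.pderiv t (F : MvPowerSeries (Fin 4) K))) := by
  classical
  intro hfin
  obtain ⟨N, hN⟩ := exists_maximalIdeal_pow_le_of_finite hfin
  have hX : (MvPowerSeries.X i : MvPowerSeries (Fin 4) K) ^ N ∈ Ideal.span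
      (Set.range fun t : Fin 4 => MvPowerSeries.pderiv t (F : MvPowerSeries (Fin 4) K)) := by
    refine hN (Ideal.pow_mem_pow ?_ N)
    rw [maximalIdeal_eq_span_X]
    exact Ideal.subset_span ⟨i, rfl⟩
  have h0 := coeff_single_eq_zero_of_mem_span_pderiv_coe h hX N
  rw [MvPowerSeries.coeff_X_pow, if_pos rfl] at h0
  exact one_ne_zero h0

/-! ## 2. Hasse derivatives of monomials -/

/-- `D^{(α)}` kills the monomial `c·x^d` unless `α ≤ d`. [folklore] -/
theorem hasseDeriv_monomial_of_not_le {α d : Fin 4 →₀ ℕ} (c : K) (h : ¬ α ≤ d) :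
    hasseDeriv α (monomial d c) = 0 := by
  classical
  ext e
  rw [IsolatedBand.coeff_hasseDeriv, coeff_monomial, coeff_zero]
  split_ifs with hde
  · exact absurd (hde ▸ le_add_self) h
  · rw [mul_zero]

/-- On a multilinear monomial (`d i ≤ 1` for all `i`) every Hasse derivative `D^{(α)}`, `α ≤ d`, has all
binomial factors `1`: `D^{(α)}(x^d) = x^{d−α}`. [folklore] -/
theorem hasseDeriv_monomial_of_le_one {α d : Fin 4 →₀ ℕ} (hd : ∀ i, d i ≤ 1) (hαd : α ≤ d) :
    hasseDeriv α (monomial d (1 : K)) = monomial (d - α) 1 := by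
  rw [UniformTrapScope.hasseDeriv_monomial' α d 1 hαd, mul_one]
  congr 1
  refine Finset.prod_eq_one fun i _ => ?_
  have hαi : α i ≤ d i := hαd i
  have hdi := hd i
  interval_cases (d i) <;> interval_cases (α i) <;> simp

/-- In characteristic `3`, `4 = 1`. [folklore] -/
theorem four_eq_one_of_charP_three [CharP K 3] : (4 : K) = 1 := by
  have h3 : (3 : K) = 0 := by simpa using CharP.cast_eq_zero K 3
  have : (4 : K) = 3 + 1 := by norm_num
  rw [this, h3, zero_add]

/-- `D^{(eⱼ)}(x_j⁴) = 4x_j³ = x_j³` in characteristic `3`. [folklore] -/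
theorem hasseDeriv_single_X_pow_four [CharP K 3] (j : Fin 4) :
    hasseDeriv (Finsupp.single j 1) (monomial (Finsupp.single j 4) (1 : K)) =
      monomial (Finsupp.single j 3) 1 := by
  have hle : Finsupp.single j 1 ≤ Finsupp.single j 4 := fun i => by
    rw [Finsupp.single_apply, Finsupp.single_apply]; split_ifs <;> omega
  rw [UniformTrapScope.hasseDeriv_monomial' _ _ 1 hle, mul_one]
  have hsub : Finsupp.single j 4 - Finsupp.single j 1 = Finsupp.single j 3 := by
    ext i
    rw [Finsupp.tsub_apply, Finsupp.single_apply, Finsupp.single_apply, Finsupp.single_apply]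
    split_ifs <;> omega
  have hrest : ∏ i ∈ (Finset.univ : Finset (Fin 4)).erase j,
      (Nat.choose (Finsupp.single j 4 i) (Finsupp.single j 1 i) : K) = 1 :=
    Finset.prod_eq_one fun i hi => by
      have hij : i ≠ j := (Finset.mem_erase.mp hi).1
      rw [Finsupp.single_eq_of_ne hij, Finsupp.single_eq_of_ne hij, Nat.choose_zero_right, Nat.cast_one]
  have hprod : (∏ i, (Nat.choose (Finsupp.single j 4 i) (Finsupp.single j 1 i) : K)) = 1 := by
    rw [← Finset.prod_erase_mul _ _ (Finset.mem_univ j), hrest, one_mul, Finsupp.single_eq_same,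
      Finsupp.single_eq_same, Nat.choose_one_right, Nat.cast_ofNat, four_eq_one_of_charP_three]
  rw [hsub, hprod]

/-- The only exponent of degree `n` supported in `{j}` is `n·eⱼ`: if `γ i = 0` for `i ≠ j` then
`γ = single j |γ|`. [folklore] -/
theorem eq_single_of_forall_ne_eq_zero {γ : Fin 4 →₀ ℕ} {j : Fin 4} (h : ∀ i, i ≠ j → γ i = 0) :
    γ = Finsupp.single j γ.degree := by
  classical
  have hdeg : γ.degree = γ j := by
    rw [Finsupp.degree_eq_sum, ← Finset.sum_erase_add _ _ (Finset.mem_univ j)]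
    rw [Finset.sum_eq_zero fun i hi => h i (Finset.mem_erase.mp hi).1, zero_add]
  ext i
  by_cases hij : i = j
  · subst hij; rw [Finsupp.single_eq_same, hdeg]
  · rw [h i hij, Finsupp.single_eq_of_ne hij]

/-- A monomial divisible by a member of an ideal is a member. [folklore] -/
theorem monomial_mem_of_le_of_mem {J : Ideal (MvPolynomial (Fin 4) K)} {β γ : Fin 4 →₀ ℕ} (hβγ : β ≤ γ)
    (hβ : monomial β (1 : K) ∈ J) : monomial γ (1 : K) ∈ J := by
  have : monomial γ (1 : K) = monomial (γ - β) 1 * monomial β 1 := by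
    rw [monomial_mul, one_mul, tsub_add_cancel_of_le hβγ]
  rw [this]
  exact Ideal.mul_mem_left _ _ hβ

/-! ## 3. The floor specimen `F = x₁x₂x₃ + x₄⁴` at `p = 3` -/

/-- `x₁x₂x₃ + x₄⁴` as a sum of two monomials. [folklore] -/
theorem floorSpecimen_eq :
    (X 0 * X 1 * X 2 + X 3 ^ 4 : MvPolynomial (Fin 4) K) =
      monomial (Finsupp.single 0 1 + Finsupp.single 1 1 + Finsupp.single 2 1) 1 +
        monomial (Finsupp.single 3 4) 1 := by
  rw [X_pow_eq_monomial, X, X, X, monomial_mul, monomial_mul, mul_one, mul_one]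

/-- The second Hasse derivatives of the floor specimen: for `α ≤ e₁ + e₂ + e₃`, `α ≠ 0`,
`D^{(α)}(x₁x₂x₃ + x₄⁴) = x^{e₁+e₂+e₃−α}`. [folklore] -/
theorem hasseDeriv_floorSpecimen_of_le {α : Fin 4 →₀ ℕ}
    (hα : α ≤ Finsupp.single 0 1 + Finsupp.single 1 1 + Finsupp.single 2 1) (hα0 : α ≠ 0) :
    hasseDeriv α (X 0 * X 1 * X 2 + X 3 ^ 4 : MvPolynomial (Fin 4) K) =
      monomial (Finsupp.single 0 1 + Finsupp.single 1 1 + Finsupp.single 2 1 - α) 1 := by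
  have hd : ∀ i, (Finsupp.single (0 : Fin 4) 1 + Finsupp.single 1 1 + Finsupp.single 2 1 :
      Fin 4 →₀ ℕ) i ≤ 1 := by
    intro i
    simp only [Finsupp.add_apply, Finsupp.single_apply]
    split_ifs <;> omega
  have hnle : ¬ α ≤ Finsupp.single (3 : Fin 4) 4 := by
    intro hle
    apply hα0
    ext i
    have h1 := hle i
    have h2 := hα i
    have h3 := hd i
    rw [Finsupp.single_apply] at h1
    simp only [Finsupp.add_apply, Finsupp.single_apply] at h2
    rw [Finsupp.coe_zero, Pi.zero_apply]
    split_ifs at h1 h2 <;> omega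
  rw [floorSpecimen_eq, IsolatedBand.hasseDeriv_add, hasseDeriv_monomial_of_le_one hd hα,
    hasseDeriv_monomial_of_not_le _ hnle, add_zero]

/-- `D^{(e₄)}(x₁x₂x₃ + x₄⁴) = x₄³` in characteristic `3`. [folklore] -/
theorem hasseDeriv_floorSpecimen_single_three [CharP K 3] :
    hasseDeriv (Finsupp.single 3 1) (X 0 * X 1 * X 2 + X 3 ^ 4 : MvPolynomial (Fin 4) K) =
      monomial (Finsupp.single 3 3) 1 := by
  have hnle : ¬ Finsupp.single (3 : Fin 4) 1 ≤
      Finsupp.single 0 1 + Finsupp.single 1 1 + Finsupp.single 2 1 := by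
    intro hle
    have h := hle 3
    simp only [Finsupp.add_apply, Finsupp.single_apply] at h
    simp at h
  rw [floorSpecimen_eq, IsolatedBand.hasseDeriv_add, hasseDeriv_monomial_of_not_le _ hnle, zero_add,
    hasseDeriv_single_X_pow_four]

/-- **`J₃⁺(x₁x₂x₃ + x₄⁴) ∋ x₁, x₂, x₃`** (as `D^{(e₂+e₃)}F`, `D^{(e₁+e₃)}F`, `D^{(e₁+e₂)}F`). [folklore] -/
theorem X_mem_singLocusIdeal_floorSpecimen {k : Fin 4} (hk : k ≠ 3) :
    (X k : MvPolynomial (Fin 4) K) ∈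
      singLocusIdeal 3 (X 0 * X 1 * X 2 + X 3 ^ 4 : MvPolynomial (Fin 4) K) := by
  classical
  set d : Fin 4 →₀ ℕ := Finsupp.single 0 1 + Finsupp.single 1 1 + Finsupp.single 2 1 with hd
  have hdk : d k = 1 := by
    rw [hd]; simp only [Finsupp.add_apply, Finsupp.single_apply]
    fin_cases k <;> simp at hk ⊢
  have hkd : Finsupp.single k 1 ≤ d := fun i => by
    rw [Finsupp.single_apply]; split_ifs with hki
    · subst hki; exact hdk.ge
    · exact Nat.zero_le _
  -- α := d − e_k has degree 2 and d − α = e_k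
  have hαle : d - Finsupp.single k 1 ≤ d := tsub_le_self
  have hdα : d - (d - Finsupp.single k 1) = Finsupp.single k 1 := tsub_tsub_cancel_of_le hkd
  have hdeg_d : d.degree = 3 := by
    rw [hd, map_add, map_add, Finsupp.degree_single, Finsupp.degree_single, Finsupp.degree_single]
  have hdeg : (d - Finsupp.single k 1).degree = 2 := by
    have h := congrArg Finsupp.degree (tsub_add_cancel_of_le hkd)
    rw [map_add, Finsupp.degree_single, hdeg_d] at h
    omega
  have hα0 : d - Finsupp.single k 1 ≠ 0 := by
    intro h0; rw [h0, map_zero] at hdeg; exact absurd hdeg (by norm_num)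
  have hD := hasseDeriv_floorSpecimen_of_le (K := K) hαle hα0
  rw [hdα] at hD
  show monomial (Finsupp.single k 1) (1 : K) ∈ _
  rw [← hD]
  exact Ideal.subset_span ⟨d - Finsupp.single k 1, by rw [hdeg]; norm_num, by rw [hdeg]; norm_num, rfl⟩

/-- **`J₃⁺(x₁x₂x₃ + x₄⁴) ∋ x₄³`** in characteristic `3` (as `D^{(e₄)}F = 4x₄³`). [folklore] -/
theorem X_pow_three_mem_singLocusIdeal_floorSpecimen [CharP K 3] :
    (X 3 ^ 3 : MvPolynomial (Fin 4) K) ∈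
      singLocusIdeal 3 (X 0 * X 1 * X 2 + X 3 ^ 4 : MvPolynomial (Fin 4) K) := by
  rw [show (X 3 ^ 3 : MvPolynomial (Fin 4) K) = monomial (Finsupp.single 3 3) 1 from
    X_pow_eq_monomial, ← hasseDeriv_floorSpecimen_single_three]
  exact Ideal.subset_span ⟨Finsupp.single 3 1, by rw [Finsupp.degree_single]; norm_num,
    by rw [Finsupp.degree_single]; norm_num, rfl⟩

/-- **The floor specimen is `J₃⁺`-ISOLATED**: over a field of characteristic `3`, the origin is an
isolated triple point of `z³ + x₁x₂x₃ + x₄⁴` in the sense of the frame (`𝔪₀³ ≤ J₃⁺(F) ≤ 𝔪₀`,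
certificate `IsolationCert.isIsolated_of_pow_le` with `N = 3`). OURS (worked instance). [folklore] -/
theorem isIsolated_three_floorSpecimen [CharP K 3] :
    IsIsolated 3 (X 0 * X 1 * X 2 + X 3 ^ 4 : MvPolynomial (Fin 4) K) := by
  classical
  refine IsolationCert.isIsolated_of_pow_le (N := 3) ?_ ?_
  · -- `J₃⁺(F) ≤ 𝔪₀`: `F` has no monomial of degree `1` or `2`
    rw [IsolatedScope.singLocusIdeal_le_originIdeal_iff]
    intro α _ hq
    have h1 : ¬ (Finsupp.single (0 : Fin 4) 1 + Finsupp.single 1 1 + Finsupp.single 2 1 = α) := by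
      intro h
      rw [← h, map_add, map_add, Finsupp.degree_single, Finsupp.degree_single,
        Finsupp.degree_single] at hq
      omega
    have h2 : ¬ (Finsupp.single (3 : Fin 4) 4 = α) := by
      intro h; rw [← h, Finsupp.degree_single] at hq; omega
    rw [floorSpecimen_eq, coeff_add, coeff_monomial, coeff_monomial, if_neg h1, if_neg h2, add_zero]
  · -- `𝔪₀³ ≤ J₃⁺(F)`: every degree-3 monomial is divisible by `x₁`, `x₂`, `x₃` or equals `x₄³`
    conv_lhs => rw [IsolationCert.originIdeal_eq_idealOfVars, MvPolynomial.pow_idealOfVars_eq_span]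
    rw [Ideal.span_le]
    rintro _ ⟨γ, hγ, rfl⟩
    show monomial γ (1 : K) ∈ singLocusIdeal 3 _
    have hγ3 : γ.degree = 3 := hγ
    by_cases hk : ∃ k : Fin 4, k ≠ 3 ∧ 1 ≤ γ k
    · obtain ⟨k, hk3, hk1⟩ := hk
      have hle : Finsupp.single k 1 ≤ γ := Finsupp.single_le_iff.mpr hk1
      have hXk : monomial (Finsupp.single k 1) (1 : K) ∈
          singLocusIdeal 3 (X 0 * X 1 * X 2 + X 3 ^ 4 : MvPolynomial (Fin 4) K) :=
        X_mem_singLocusIdeal_floorSpecimen (K := K) hk3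
      exact monomial_mem_of_le_of_mem hle hXk
    · push Not at hk
      have hγeq : γ = Finsupp.single 3 γ.degree :=
        eq_single_of_forall_ne_eq_zero fun i hi => Nat.lt_one_iff.mp (hk i hi)
      rw [hγ3] at hγeq
      rw [hγeq, ← X_pow_eq_monomial]
      exact X_pow_three_mem_singLocusIdeal_floorSpecimen

/-- **The floor specimen is MILNOR-INFINITE**: `∂F = (x₂x₃, x₁x₃, x₁x₂, 4x₄³)` vanishes on the
`x₁`-axis, so `K⟦x⟧ ⧸ ⟨∂ᵢ ↑F⟩` is not finite over `K` (any characteristic). OURS (worked instance).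
[folklore] -/
theorem not_milnorFinite_floorSpecimen :
    ¬ Module.Finite K (MvPowerSeries (Fin 4) K ⧸ Ideal.span (Set.range fun t : Fin 4 =>
      MvPowerSeries.pderiv t ((X 0 * X 1 * X 2 + X 3 ^ 4 : MvPolynomial (Fin 4) K) :
        MvPowerSeries (Fin 4) K))) := by
  classical
  refine not_milnorFinite_of_coeff_single_pderiv_eq_zero 0 fun t n => ?_
  rw [floorSpecimen_eq, map_add, pderiv_monomial, pderiv_monomial, coeff_add, coeff_monomial,
    coeff_monomial]
  have h1 : Finsupp.single (0 : Fin 4) 1 + Finsupp.single 1 1 + Finsupp.single 2 1 -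
      Finsupp.single t 1 ≠ Finsupp.single 0 n := by
    intro h
    -- a coordinate `≠ 0, t` of the left side equals `1`, of the right side `0`
    have hc : ∃ c : Fin 4, c ≠ 0 ∧ c ≠ t ∧ c ≠ 3 := by
      fin_cases t
      · exact ⟨1, by decide, by decide, by decide⟩
      · exact ⟨2, by decide, by decide, by decide⟩
      · exact ⟨1, by decide, by decide, by decide⟩
      · exact ⟨1, by decide, by decide, by decide⟩
    obtain ⟨c, hc0, hct, hc3⟩ := hc
    have h' := congrArg (fun f : Fin 4 →₀ ℕ => f c) h
    simp only [Finsupp.tsub_apply, Finsupp.add_apply, Finsupp.single_apply, if_neg hc0.symm,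
      if_neg hct.symm] at h'
    fin_cases c <;> simp at hc0 hc3 h'
  by_cases ht : t = 3
  · subst ht
    have h2 : Finsupp.single (3 : Fin 4) 4 - Finsupp.single 3 1 ≠ Finsupp.single 0 n := by
      intro h
      have h' := congrArg (fun f : Fin 4 →₀ ℕ => f 3) h
      simp only [Finsupp.tsub_apply, Finsupp.single_apply] at h'
      simp at h'
    rw [if_neg h1, if_neg h2, add_zero]
  · have h4 : (Finsupp.single (3 : Fin 4) 4) t = 0 := Finsupp.single_eq_of_ne ht
    rw [h4, Nat.cast_zero, mul_zero, if_neg h1, zero_add]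
    split_ifs <;> rfl

end WildConesBridge

end Summit.ResolutionOfSingularities.ResolutionOfSingularities.Theorems.PIDim4

end
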